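import Mathlib
import Literature.Computability.AlgebraicComplexity.NewtonPolygonTauBounds

/-!
# Crux `NewtonTauWeak` (stmt-ValiantsHypothesis-5904), line `slope-ladder`: SHADOW and PROJECTION bounds

Two bookkeeping inequalities for convexly independent subsets `S` of planar Minkowski sums, used throughout the
census of STUB 1 (`stub_blockConvexBound`, the `M_r(N)` problem of [BBFKOTT10 §5]) to kill construction families
at `r = 4` in one line each (`Cruxes/NewtonTauWeak/CENSUS-stub_blockConvexBound-valwidth-p1.md`, v4):

* **Projection bound** (`card_filter_eq_le_two`, `card_le_two_mul_card_image`,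
  `card_le_two_mul_card_sum_image`): a line meets a convexly independent finite set in at most two points, so
  for every nonzero linear functional `ψ : ℝ² → ℝ` one has `#S ≤ 2 · #ψ(S)`, and if `S ⊆ P_1 + ⋯ + P_r` then
  `#S ≤ 2 · #(ψ(P_1) + ⋯ + ψ(P_r))` (a sumset of reals).  This is the "distinctness" obstruction: every
  direction must see `≥ #S / 2` distinct projected sums (it kills the Cartesian-product, lattice × Jarník and
  axis-aligned exponential-curve families, and it is the `σ`-collapse of every bounded-height rational identity).
* **Linear regime of Eisenbrand–Pach–Rothvoß–Sopher** (`card_le_of_subset_add_of_sq_le`): if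
  `S ⊆ X + Y` with `#Y² ≤ #X` then `#S ≤ 48 · #X` (from the in-tree effective EPRS bound
  `KPTT.EPRS.card_le_of_convexIndependent_subset_add`, constant `16`).  SHADOW PRINCIPLE for four summands of
  size `≤ n`: a convex chain `S ⊆ P_1+P_2+P_3+P_4` that only uses a set `W` of `≤ K n²` (`K ≥ 1`) partial sums from
  three of the summands satisfies `S ⊆ W + P_j`, hence `#S ≤ 48 K n²` — so "Lagrange `n²`-chain plus a fourth
  set", Skomra–Thomassé doubling on top of it, and every ridge family with a decoupled direction are `O(n²)`:
  to beat `n²` at `r = 4` all four triple shadows must have `≫ n²` points (`card_le_of_subset_add_three_one`).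

Helper file for the crux item (`--supports`); nothing here bears on `NewtonTauWeak` or on `VP ≠ VNP`.
-/

set_option linter.dupNamespace false

namespace Summit.ValiantsHypothesis.ValiantsHypothesis.Theorems.NewtonFramesNewtonTauWeak.BlockConvexShadow

open scoped BigOperators Pointwise
open Literature.Computability.AlgebraicComplexity.KPTT.EPRS (card_le_of_convexIndependent_subset_add)

noncomputable section

/-! ### 1. A line meets a convexly independent set in at most two points -/

/-- Coordinates of a point of the line `a x + b y = c` in terms of the transversal coordinate
`φ = -b x + a y`: `x = (a c - b φ)/(a²+b²)`, `y = (b c + a φ)/(a²+b²)`. [folklore] -/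
theorem coord_eq_of_mem_line (a b c : ℝ) (hab : a ^ 2 + b ^ 2 ≠ 0) (p : Fin 2 → ℝ)
    (hp : a * p 0 + b * p 1 = c) :
    p 0 = (a * c - b * (-b * p 0 + a * p 1)) / (a ^ 2 + b ^ 2) ∧
      p 1 = (b * c + a * (-b * p 0 + a * p 1)) / (a ^ 2 + b ^ 2) := by
  constructor
  · field_simp
    rw [← hp]; ring
  · field_simp
    rw [← hp]; ring

/-- On a line `a x + b y = c`, a point whose transversal coordinate `φ = -b x + a y` lies strictly between those
of two other points of the line lies on the segment joining them. [folklore] -/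
theorem mem_segment_of_between (a b c : ℝ) (hab : a ^ 2 + b ^ 2 ≠ 0) (p q r : Fin 2 → ℝ)
    (hp : a * p 0 + b * p 1 = c) (hq : a * q 0 + b * q 1 = c) (hr : a * r 0 + b * r 1 = c)
    (h₁ : -b * p 0 + a * p 1 < -b * q 0 + a * q 1) (h₂ : -b * q 0 + a * q 1 < -b * r 0 + a * r 1) :
    q ∈ segment ℝ p r := by
  set fp : ℝ := -b * p 0 + a * p 1 with hfp
  set fq : ℝ := -b * q 0 + a * q 1 with hfq
  set fr : ℝ := -b * r 0 + a * r 1 with hfr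
  have hpr : fp < fr := h₁.trans h₂
  have hden : fr - fp ≠ 0 := by linarith
  set t : ℝ := (fq - fp) / (fr - fp) with ht
  have ht0 : 0 ≤ t := div_nonneg (by linarith) (by linarith)
  have ht1 : t ≤ 1 := by rw [ht, div_le_one (by linarith)]; linarith
  have htq : fq = (1 - t) * fp + t * fr := by
    rw [ht]; field_simp; ring
  obtain ⟨hp0, hp1⟩ := coord_eq_of_mem_line a b c hab p hp
  obtain ⟨hq0, hq1⟩ := coord_eq_of_mem_line a b c hab q hq
  obtain ⟨hr0, hr1⟩ := coord_eq_of_mem_line a b c hab r hr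
  refine ⟨1 - t, t, by linarith, ht0, by ring, ?_⟩
  funext i
  fin_cases i
  · simp only [Fin.zero_eta, Fin.isValue, Pi.add_apply, Pi.smul_apply, smul_eq_mul]
    rw [hq0, hp0, hr0, ← hfp, ← hfq, ← hfr, htq]
    field_simp
    ring
  · simp only [Fin.mk_one, Fin.isValue, Pi.add_apply, Pi.smul_apply, smul_eq_mul]
    rw [hq1, hp1, hr1, ← hfp, ← hfq, ← hfr, htq]
    field_simp
    ring

/-- A nonzero linear functional on `ℝ²` is `p ↦ a p₀ + b p₁` with `(a, b) ≠ (0, 0)`. [folklore] -/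
theorem linearMap_apply_eq (ψ : (Fin 2 → ℝ) →ₗ[ℝ] ℝ) (p : Fin 2 → ℝ) :
    ψ p = ψ (Pi.single 0 1) * p 0 + ψ (Pi.single 1 1) * p 1 := by
  have : p = p 0 • (Pi.single 0 1 : Fin 2 → ℝ) + p 1 • (Pi.single 1 1 : Fin 2 → ℝ) := by
    funext i; fin_cases i <;> simp
  conv_lhs => rw [this]
  rw [map_add, map_smul, map_smul, smul_eq_mul, smul_eq_mul]
  ring

/-- If `ψ ≠ 0` then `(ψ e₀)² + (ψ e₁)² ≠ 0`. [folklore] -/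
theorem sq_add_sq_ne_zero_of_ne_zero (ψ : (Fin 2 → ℝ) →ₗ[ℝ] ℝ) (hψ : ψ ≠ 0) :
    ψ (Pi.single 0 1) ^ 2 + ψ (Pi.single 1 1) ^ 2 ≠ 0 := by
  intro h
  have h0 : ψ (Pi.single 0 1) = 0 := by nlinarith [sq_nonneg (ψ (Pi.single 0 1)), sq_nonneg (ψ (Pi.single 1 1))]
  have h1 : ψ (Pi.single 1 1) = 0 := by nlinarith [sq_nonneg (ψ (Pi.single 0 1)), sq_nonneg (ψ (Pi.single 1 1))]
  apply hψ
  ext i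
  fin_cases i
  · simpa using h0
  · simpa using h1

/-- **A line meets a convexly independent finite set in at most two points**: for a nonzero linear functional
`ψ` on `ℝ²` and any value `c`, at most two points of a convexly independent finite `S` have `ψ = c` (of three
collinear points one lies on the segment of the other two, hence in the hull of `S` minus itself). [folklore] -/
theorem card_filter_eq_le_two (S : Finset (Fin 2 → ℝ))
    (hci : ConvexIndependent ℝ (Subtype.val : ↥(S : Set (Fin 2 → ℝ)) → (Fin 2 → ℝ)))
    (ψ : (Fin 2 → ℝ) →ₗ[ℝ] ℝ) (hψ : ψ ≠ 0) (c : ℝ) :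
    (S.filter fun p => ψ p = c).card ≤ 2 := by
  classical
  by_contra hlt
  push Not at hlt
  obtain ⟨x, hx, y, hy, z, hz, hxy, hxz, hyz⟩ := Finset.two_lt_card.1 hlt
  set a : ℝ := ψ (Pi.single 0 1) with ha
  set b : ℝ := ψ (Pi.single 1 1) with hb
  have hab : a ^ 2 + b ^ 2 ≠ 0 := sq_add_sq_ne_zero_of_ne_zero ψ hψ
  -- membership in S and on the line
  have hxS : x ∈ S := (Finset.mem_filter.1 hx).1
  have hyS : y ∈ S := (Finset.mem_filter.1 hy).1
  have hzS : z ∈ S := (Finset.mem_filter.1 hz).1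
  have hlx : a * x 0 + b * x 1 = c := by rw [← (Finset.mem_filter.1 hx).2, linearMap_apply_eq ψ x]
  have hly : a * y 0 + b * y 1 = c := by rw [← (Finset.mem_filter.1 hy).2, linearMap_apply_eq ψ y]
  have hlz : a * z 0 + b * z 1 = c := by rw [← (Finset.mem_filter.1 hz).2, linearMap_apply_eq ψ z]
  -- transversal coordinates are pairwise distinct
  have hinj : ∀ p q : Fin 2 → ℝ, a * p 0 + b * p 1 = c → a * q 0 + b * q 1 = c →
      -b * p 0 + a * p 1 = -b * q 0 + a * q 1 → p = q := by
    intro p q hp hq hφ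
    obtain ⟨hp0, hp1⟩ := coord_eq_of_mem_line a b c hab p hp
    obtain ⟨hq0, hq1⟩ := coord_eq_of_mem_line a b c hab q hq
    funext i
    fin_cases i
    · simp only [Fin.zero_eta, Fin.isValue]; rw [hp0, hq0, hφ]
    · simp only [Fin.mk_one, Fin.isValue]; rw [hp1, hq1, hφ]
  -- the middle point lies in the hull of the other two: contradiction with convex independence
  have key : ∀ p q r : Fin 2 → ℝ, p ∈ S → q ∈ S → r ∈ S → p ≠ q → q ≠ r →
      a * p 0 + b * p 1 = c → a * q 0 + b * q 1 = c → a * r 0 + b * r 1 = c →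
      -b * p 0 + a * p 1 < -b * q 0 + a * q 1 → -b * q 0 + a * q 1 < -b * r 0 + a * r 1 → False := by
    intro p q r hpS hqS hrS hpq hqr hp hq hr h₁ h₂
    have hseg := mem_segment_of_between a b c hab p q r hp hq hr h₁ h₂
    have hsub : segment ℝ p r ⊆ convexHull ℝ ((S : Set (Fin 2 → ℝ)) \ {q}) :=
      segment_subset_convexHull ⟨Finset.mem_coe.2 hpS, fun h => hpq h⟩
        ⟨Finset.mem_coe.2 hrS, fun h => hqr h.symm⟩
    exact (convexIndependent_set_iff_notMem_convexHull_sdiff.1 hci) q (Finset.mem_coe.2 hqS) (hsub hseg)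
  set fx : ℝ := -b * x 0 + a * x 1 with hfx
  set fy : ℝ := -b * y 0 + a * y 1 with hfy
  set fz : ℝ := -b * z 0 + a * z 1 with hfz
  have nxy : fx ≠ fy := fun h => hxy (hinj x y hlx hly h)
  have nxz : fx ≠ fz := fun h => hxz (hinj x z hlx hlz h)
  have nyz : fy ≠ fz := fun h => hyz (hinj y z hly hlz h)
  rcases lt_or_gt_of_ne nxy with hxy' | hxy'
  · rcases lt_or_gt_of_ne nyz with hyz' | hyz'
    · exact key x y z hxS hyS hzS hxy hyz hlx hly hlz hxy' hyz'
    · rcases lt_or_gt_of_ne nxz with hxz' | hxz'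
      · exact key x z y hxS hzS hyS hxz hyz.symm hlx hlz hly hxz' hyz'
      · exact key z x y hzS hxS hyS hxz.symm hxy hlz hlx hly hxz' hxy'
  · rcases lt_or_gt_of_ne nyz with hyz' | hyz'
    · rcases lt_or_gt_of_ne nxz with hxz' | hxz'
      · exact key y x z hyS hxS hzS hxy.symm hxz hly hlx hlz hxy' hxz'
      · exact key y z x hyS hzS hxS hyz hxz.symm hly hlz hlx hyz' hxz'
    · exact key z y x hzS hyS hxS hyz.symm hxy.symm hlz hly hlx hyz' hxy'

/-! ### 2. The projection bound -/

/-- **Projection bound**: a convexly independent finite `S ⊆ ℝ²` has at most twice as many points as any of its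
one-dimensional linear projections `ψ(S)`, `ψ ≠ 0`. [folklore] -/
theorem card_le_two_mul_card_image (S : Finset (Fin 2 → ℝ))
    (hci : ConvexIndependent ℝ (Subtype.val : ↥(S : Set (Fin 2 → ℝ)) → (Fin 2 → ℝ)))
    (ψ : (Fin 2 → ℝ) →ₗ[ℝ] ℝ) (hψ : ψ ≠ 0) :
    S.card ≤ 2 * (S.image ψ).card := by
  classical
  exact Finset.card_le_mul_card_image S 2 fun c _ => card_filter_eq_le_two S hci ψ hψ c

/-- **Projection bound for Minkowski sums** (the distinctness obstruction of the census): if `S ⊆ Σ_i P_i` is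
convexly independent then for every nonzero linear functional `ψ` the ONE-dimensional sumset `Σ_i ψ(P_i) ⊆ ℝ`
has at least `#S / 2` elements.  So every direction must see many distinct projected sums: e.g. four sets on two
axis directions (`ψ` = that axis) give `#S ≤ 2 #(A + C)`. [this file] -/
theorem card_le_two_mul_card_sum_image {ι : Type*} [Fintype ι] (P : ι → Finset (Fin 2 → ℝ))
    (S : Finset (Fin 2 → ℝ)) (hS : S ⊆ ∑ i, P i)
    (hci : ConvexIndependent ℝ (Subtype.val : ↥(S : Set (Fin 2 → ℝ)) → (Fin 2 → ℝ)))
    (ψ : (Fin 2 → ℝ) →ₗ[ℝ] ℝ) (hψ : ψ ≠ 0) :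
    S.card ≤ 2 * (∑ i, (P i).image ψ).card := by
  classical
  refine (card_le_two_mul_card_image S hci ψ hψ).trans (Nat.mul_le_mul_left 2 (Finset.card_le_card ?_))
  have himg : (∑ i, P i).image ψ = ∑ i, (P i).image ψ := by
    have h := map_sum (Finset.imageAddMonoidHom ψ) P Finset.univ
    simp only [Finset.imageAddMonoidHom_apply] at h
    exact h
  rw [← himg]
  exact Finset.image_subset_image hS

/-! ### 3. The linear regime of Eisenbrand–Pach–Rothvoß–Sopher (shadow principle) -/

/-- Real bookkeeping: `x^{2/3} y^{2/3} ≤ x` when `0 ≤ y`, `y² ≤ x`. [folklore] -/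
theorem rpow_two_thirds_mul_le (x y : ℝ) (hx : 0 ≤ x) (hy : 0 ≤ y) (h : y ^ 2 ≤ x) :
    x ^ ((2 : ℝ) / 3) * y ^ ((2 : ℝ) / 3) ≤ x := by
  have hy' : y ≤ x ^ ((1 : ℝ) / 2) := by
    have : y = (y ^ 2) ^ ((1 : ℝ) / 2) := by
      rw [← Real.sqrt_eq_rpow, Real.sqrt_sq hy]
    rw [this]
    exact Real.rpow_le_rpow (by positivity) h (by norm_num)
  have hxy : x * y ≤ x ^ ((3 : ℝ) / 2) := by
    calc x * y ≤ x * x ^ ((1 : ℝ) / 2) := mul_le_mul_of_nonneg_left hy' hx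
      _ = x ^ ((3 : ℝ) / 2) := by
          rcases eq_or_lt_of_le hx with h0 | h0
          · rw [← h0]; simp
          · rw [show ((3 : ℝ) / 2) = 1 + 1 / 2 by norm_num, Real.rpow_add h0, Real.rpow_one]
  calc x ^ ((2 : ℝ) / 3) * y ^ ((2 : ℝ) / 3) = (x * y) ^ ((2 : ℝ) / 3) := (Real.mul_rpow hx hy).symm
    _ ≤ (x ^ ((3 : ℝ) / 2)) ^ ((2 : ℝ) / 3) := Real.rpow_le_rpow (by positivity) hxy (by norm_num)
    _ = x := by rw [← Real.rpow_mul hx]; norm_num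

/-- **Linear regime of EPRS**: if `S ⊆ X + Y` is convexly independent and `#Y² ≤ #X`, then `#S ≤ 48 · #X`
(the `#X^{2/3}#Y^{2/3}` term is dominated by `#X`).  SHADOW PRINCIPLE: with `#P_i ≤ n`, a convex chain in
`P_1+P_2+P_3+P_4` that factors through a set `W ⊇` the partial sums it uses from three of the summands, with
`n² ≤ #W`, has `#S ≤ 48 #W`; in particular any construction through an intermediate `O(n²)`-point set (the
Lagrange `n²`-chain plus a fourth set; Skomra–Thomassé doubling on top of it) is `O(n²)`. [this file] -/
theorem card_le_of_subset_add_of_sq_le (X Y S : Finset (Fin 2 → ℝ)) (hS : S ⊆ X + Y)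
    (hci : ConvexIndependent ℝ (Subtype.val : ↥(S : Set (Fin 2 → ℝ)) → (Fin 2 → ℝ)))
    (hXY : Y.card ^ 2 ≤ X.card) :
    (S.card : ℝ) ≤ 48 * X.card := by
  have hE := card_le_of_convexIndependent_subset_add X Y S hS hci
  have hx : (0 : ℝ) ≤ X.card := Nat.cast_nonneg _
  have hy : (0 : ℝ) ≤ Y.card := Nat.cast_nonneg _
  have hsq : ((Y.card : ℝ)) ^ 2 ≤ X.card := by exact_mod_cast hXY
  have h1 : (X.card : ℝ) ^ ((2 : ℝ) / 3) * (Y.card : ℝ) ^ ((2 : ℝ) / 3) ≤ X.card :=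
    rpow_two_thirds_mul_le _ _ hx hy hsq
  have h2 : (Y.card : ℝ) ≤ X.card := by
    have hYle : Y.card ≤ X.card := by
      rcases Nat.eq_zero_or_pos Y.card with h0 | h0
      · omega
      · nlinarith
    exact_mod_cast hYle
  linarith

/-- The symmetric linear regime: `#X² ≤ #Y` gives `#S ≤ 48 · #Y`. [this file] -/
theorem card_le_of_subset_add_of_sq_le' (X Y S : Finset (Fin 2 → ℝ)) (hS : S ⊆ X + Y)
    (hci : ConvexIndependent ℝ (Subtype.val : ↥(S : Set (Fin 2 → ℝ)) → (Fin 2 → ℝ)))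
    (hXY : X.card ^ 2 ≤ Y.card) :
    (S.card : ℝ) ≤ 48 * Y.card :=
  card_le_of_subset_add_of_sq_le Y X S (by rwa [add_comm]) hci hXY

/-- **Shadow principle, four summands**: if `S ⊆ W + P` is convexly independent, `#P ≤ n` and `n² ≤ #W`
(e.g. `W` = the set of partial sums from three summands of size `≤ n` that the chain actually uses, as soon as it
has `≥ n²` elements), then `#S ≤ 48 · #W`.  Contrapositive: a chain of length `L > 48 n²` uses more than `L/48`
distinct partial sums from EVERY three of its four summands. [this file] -/
theorem card_le_of_subset_add_three_one (W P S : Finset (Fin 2 → ℝ)) (n : ℕ) (hS : S ⊆ W + P)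
    (hci : ConvexIndependent ℝ (Subtype.val : ↥(S : Set (Fin 2 → ℝ)) → (Fin 2 → ℝ)))
    (hP : P.card ≤ n) (hW : n ^ 2 ≤ W.card) :
    (S.card : ℝ) ≤ 48 * W.card :=
  card_le_of_subset_add_of_sq_le W P S hS hci ((Nat.pow_le_pow_left hP 2).trans hW)

end

end Summit.ValiantsHypothesis.ValiantsHypothesis.Theorems.NewtonFramesNewtonTauWeak.BlockConvexShadow
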